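import Mathlib
import Literature.Computability.AlgebraicComplexity.GCT
import Literature.RingTheory.Nullstellensatz.SkodaBrownawellDegreeBound
import Summits.ValiantsHypothesis.ValiantsHypothesis.Theses.RefutationDegree
import Summits.ValiantsHypothesis.ValiantsHypothesis.Theorems.RefutationDegreeDefs
import Summits.ValiantsHypothesis.ValiantsHypothesis.Theorems.RefutationDegreeRefutationBarrierConverse

/-!
# Crux `RefutationBarrier` (stmt-ValiantsHypothesis-5642): FALSE modulo Mulmuley–Sohoni + Skoda–Brownawell

Lead's file (line `Sketch-ideator1`).  `Theorems/RefutationDegreeRefutationBarrierConverse.lean` shows,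
modulo the named analytic fact `skodaBrownawellDegreeBound` (Skoda 1972 / Brownawell 1987: a
Łojasiewicz inequality at infinity gives a Nullstellensatz identity of LINEAR degree), that the crux
forces `X₀₀^{m₁-n} per_n ∈ Δ[det_{m₁}]` for all large `n`, `m₁ = ⌊n²/2⌋+1`.  The Mulmuley–Sohoni
conjecture (`Literature.Computability.AlgebraicComplexity.MulmuleySohoniConjecture`, MS 2001 Conj. 4.3,
already at the exponent `c = 2`: `X₀₀^{m-n} per_n ∉ Δ[det_m]` for `n ≤ m ≤ n²`, `n` large) says the
opposite.  Hence `not_refutationBarrier_of_mulmuleySohoni : (∀ n m, Skoda–Brownawell at the unknowns of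
Rep(n,m)) → MulmuleySohoniConjecture → ¬ RefutationBarrier` — the barrier horn of route
RefutationDegree contradicts the central conjecture of geometric complexity theory (given classical
complex analysis).  Nothing here is a verdict on the crux: both hypotheses are undischarged (one open,
one Lean-XL); the `Negative/…FalseOf…` packaging is left to the crux's refuter seat.
-/

-- `Summit.ValiantsHypothesis.ValiantsHypothesis.…` is the tree's mandated single-conjunct layout
-- (Sub = Summit), so the duplicated namespace component is intended.
set_option linter.dupNamespace false

noncomputable section

namespace Summit.ValiantsHypothesis.ValiantsHypothesis.Theorems.RefutationDegree

open Literature.Computability.AlgebraicComplexity (paddedPerPoly orbitClosure detPoly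
  MulmuleySohoniConjecture)
open Literature.RingTheory.Nullstellensatz (skodaBrownawellDegreeBound)
open Summit.ValiantsHypothesis.ValiantsHypothesis.Theses.RefutationDegree

/-- **Mulmuley–Sohoni refutes the barrier horn (modulo Skoda–Brownawell).** If the Skoda–Brownawell
degree bound holds at the unknowns of every Rep(n,m) and the Mulmuley–Sohoni conjecture holds, then
`RefutationBarrier` is false: MS at exponent `2` puts `X₀₀^{m₁-n} per_n` outside `Δ[det_{m₁}]`,
`m₁ = ⌊n²/2⌋+1 ≤ n²`, for all large `n`, and `not_refutationBarrier_of_io_notMem_orbitClosure` applies. -/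
theorem not_refutationBarrier_of_mulmuleySohoni
    (hSB : ∀ n m : ℕ, skodaBrownawellDegreeBound (σ := Unk n m) (ι := (Fin n × Fin n) →₀ ℕ))
    (hMS : MulmuleySohoniConjecture) : ¬ RefutationBarrier := by
  refine not_refutationBarrier_of_io_notMem_orbitClosure hSB fun n₀ => ?_
  obtain ⟨n₁, hn₁⟩ := hMS 2
  refine ⟨max n₀ (max n₁ 2), le_max_left _ _, ?_⟩
  set n := max n₀ (max n₁ 2) with hn
  have hn1 : n₁ ≤ n := le_trans (le_max_left _ _) (le_max_right _ _)
  have hn2 : 2 ≤ n := le_trans (le_max_right _ _) (le_max_right _ _)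
  have hsq : n ^ 2 / 2 + 1 ≤ n ^ 2 := by
    have h4 : 4 ≤ n ^ 2 := by nlinarith
    omega
  exact hn₁ n hn1 (n ^ 2 / 2 + 1) (le_quadSize n) hsq

end Summit.ValiantsHypothesis.ValiantsHypothesis.Theorems.RefutationDegree

end
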